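import Summits.AnomalousDissipation.AnomalousDissipation.Theses.DutyCycle
import Literature.Analysis.FluidPDE.LerayHopfUniformEnergy
import Literature.Analysis.FluidPDE.LongTimeAverageShift
import Literature.Analysis.FluidPDE.LongTimeAverageSubadditive
import HarnessLib

/-! # BC5 RUNG for crux `DutyCycle.DenseReturnsLandSlim` (item stmt-AnomalousDissipation-27341) — decomp-ad lens-3 g59

LANDABLE FORM (intended tree path `Summits/AnomalousDissipation/AnomalousDissipation/Theorems/DutyCycleDenseReturnsLandSlimRung.lean`,
namespace `Summit.AnomalousDissipation.AnomalousDissipation.Theorems.DutyCycle`; a prover-identity seat lands it with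
`ledger propose --target <that path> --supports stmt-AnomalousDissipation-27341` — it proves the registered theorem-grade stub
`stub_slimGapEnergy` BY NAME + SIGNATURE and the BC5 rung; planners do not propose into Theorems/).

`denseReturnsLandSlim_rung : DenseSyndeticSlimReturns → DutyCycle.SlimMeanDenseReturns` — the crux Rβf (`D → D_E`, FAT
CONTROL) RESTRICTED TO SYNDETIC-SLIM FAMILIES, now a THEOREM (0 sorry): of the registered BC3 line «syndetic slim instants
bound the mean energy» (skeleton `DenseReturnsLandSlim_birth(_paste).lean`, stubs `stub_denseToSyndeticSlim` (OPEN,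
IDEA-NEEDED, sufficient-only) and `stub_slimGapEnergy` (theorem-grade)), the theorem-grade stub is PROVED here verbatim
(`slimGapEnergy`), with the SHARP constant `(√B + ‖f‖₂ G)²` the skeleton registered.

Why the rung lies outside S's known regime and exercises the lever: it converts a pure RETURN-TIME STATISTIC (ν-free
bounded gaps `G` between SLIM restart-good instants, no measure, no mean) into the ν-free MEAN-ENERGY budget
`E = (√B + ‖f‖₂ G)²` — the currency `D_E` of the child route (item 27343) — using only the Leray–Hopf energy inequality
from a restart, Cauchy–Schwarz, and a square-root Bihari comparison (`‖u(t+r)‖₂ ≤ √B + ‖f‖₂ r`, no Grönwall exponential,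
no Poincaré, hence UNIFORM IN VISCOSITY); no statement about `limsup ν⟨‖∇u‖²⟩` (S) is known for such families.

* §1 `le_of_increments_le_sq`, `sq_bound_of_sqrt_integral_ineq` — pure real analysis: a function with increments
  `≤ C·(length)²` does not increase (telescoping), whence the square-root Bihari lemma
  `y ≤ B + 2F∫₀√y ⟹ y(r) ≤ (√B + F r)²` (for `B > 0`; the `B ≥ 0` case by `ε`-regularisation downstream).
* §2 `integral_inner_le_sqrt_mul_sqrt` (Cauchy–Schwarz, local copy of the tree's folklore lemma),
  `intervalIntegrable_sqrt_energy`, `energy_le_sq_of_restart` — `∫‖w(r)‖² ≤ (√B + ‖f‖₂ r)²` along a global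
  Leray–Hopf solution restarted from a slim datum (`energy_ineq_zero` of the restart).
* §3 `slimGapEnergy` (= registered `stub_slimGapEnergy`, verbatim) and the rung, with the ∃-statement «DENSE +
  SYNDETIC-SLIM RETURNS» (`DenseSyndeticSlimReturns` of the registered BC3 skeleton, verbatim) INLINED as its antecedent
  (kernel lane; no `def … : Prop` in a Theorems proof file).
Tree facts used BY NAME: `Torus.IsLerayHopfOn.energy_ineq_zero` [Leray1934, (5.2); Galdi2000, Def. 2.1 (ii)],
`Torus.IsGlobalLerayHopf.meanEnergy_translate`, `longTimeAvgSup_le_const`, `IsGlobalLerayHopf.memLp_two`,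
`IsGlobalLerayHopf.integrableOn_integral_norm_sq`; Mathlib `integral_mul_le_Lp_mul_Lq_of_nonneg`, `Finset.sum_range_sub`. -/

noncomputable section

-- `Summit.<Summit>.<Problem>` is the tree's mandated summit-side namespace (CONVENTIONS §2); for this
-- single-conjunct summit the two segments coincide, so the duplicate is deliberate.
set_option linter.dupNamespace false

open MeasureTheory Set Filter Topology
open scoped RealInnerProductSpace
open Literature.Analysis Literature.Analysis.FluidPDE Literature.Analysis.FluidPDE.Torus

namespace Summit.AnomalousDissipation.AnomalousDissipation.Theorems.DutyCycle

/-! ### §1 Real analysis: telescoping and the square-root Bihari lemma -/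

/-- **Telescoping.** A real function whose increments on `[a, b]` are bounded by `C·(length)²` does not increase
from `a` to `b`: over `n` equal steps `h b - h a ≤ C (b - a)² / n` for every `n ≥ 1`. -/
theorem le_of_increments_le_sq {h : ℝ → ℝ} {C a b : ℝ} (hC : 0 ≤ C) (hab : a ≤ b)
    (H : ∀ r r' : ℝ, a ≤ r → r ≤ r' → r' ≤ b → h r' - h r ≤ C * (r' - r) ^ 2) : h b ≤ h a := by
  have key : ∀ n : ℕ, 0 < n → h b - h a ≤ C * (b - a) ^ 2 / n := by
    intro n hn
    have hn' : (0:ℝ) < n := by exact_mod_cast hn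
    set δ : ℝ := (b - a) / n with hδ
    have hδ0 : 0 ≤ δ := div_nonneg (sub_nonneg.2 hab) hn'.le
    have hnδ : (n : ℝ) * δ = b - a := by
      rw [hδ]
      field_simp
    set r : ℕ → ℝ := fun k => a + k * δ with hr
    have hr0 : r 0 = a := by simp [hr]
    have hrn : r n = b := by
      simp only [hr]
      linarith
    have hstep : ∀ k : ℕ, r (k + 1) - r k = δ := by
      intro k
      simp only [hr]
      push_cast
      ring
    have hsum : ∑ k ∈ Finset.range n, (h (r (k + 1)) - h (r k)) = h b - h a := by
      rw [Finset.sum_range_sub (fun k => h (r k)) n, hrn, hr0]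
    have hbound : ∀ k ∈ Finset.range n, h (r (k + 1)) - h (r k) ≤ C * δ ^ 2 := by
      intro k hk
      have hk' : k < n := Finset.mem_range.1 hk
      have hk0 : (0:ℝ) ≤ k := Nat.cast_nonneg k
      have h1 : a ≤ r k := by
        simp only [hr]
        nlinarith
      have h2 : r k ≤ r (k + 1) := by linarith [hstep k]
      have h3 : r (k + 1) ≤ b := by
        have hk1 : ((k:ℝ) + 1) ≤ n := by exact_mod_cast hk'
        have : r (k + 1) = a + ((k:ℝ) + 1) * δ := by
          simp only [hr]
          push_cast
          ring
        rw [this]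
        nlinarith
      have := H (r k) (r (k + 1)) h1 h2 h3
      rwa [hstep k] at this
    calc h b - h a = ∑ k ∈ Finset.range n, (h (r (k + 1)) - h (r k)) := hsum.symm
      _ ≤ ∑ k ∈ Finset.range n, C * δ ^ 2 := Finset.sum_le_sum hbound
      _ = n * (C * δ ^ 2) := by rw [Finset.sum_const, Finset.card_range, nsmul_eq_mul]
      _ = C * (b - a) ^ 2 / n := by
          rw [← hnδ]
          field_simp
  have hε : ∀ ε : ℝ, 0 < ε → h b - h a ≤ ε := by
    intro ε hε
    obtain ⟨n, hn⟩ := exists_nat_gt (C * (b - a) ^ 2 / ε)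
    have hq0 : 0 ≤ C * (b - a) ^ 2 / ε := by positivity
    have hn0 : (0:ℝ) < n := hq0.trans_lt hn
    have hnpos : 0 < n := by exact_mod_cast hn0
    have h1 := key n hnpos
    have h2 : C * (b - a) ^ 2 < n * ε := (div_lt_iff₀ hε).1 hn
    have h3 : C * (b - a) ^ 2 / n ≤ ε := by
      rw [div_le_iff₀ hn0]
      linarith
    linarith
  have h0 : h b - h a ≤ 0 := by
    by_contra hcon
    push Not at hcon
    have := hε ((h b - h a) / 2) (by linarith)
    linarith
  linarith

/-- **Square-root Bihari lemma** (`B > 0`). If `√y` (`Real.sqrt`, so `y` need not be signed) is interval integrable on `[0, R]` and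
`y r ≤ B + 2F ∫₀ʳ √y` for every `r ∈ [0, R]`, then `y r ≤ (√B + F r)²` on `[0, R]`: the function
`r ↦ √(B + 2F∫₀ʳ√y) - F r` has increments `≤ (2F²/√B)·(length)²`, so it does not increase (no continuity of `y`
is needed). -/
theorem sq_bound_of_sqrt_integral_ineq {y : ℝ → ℝ} {B F R : ℝ} (hB : 0 < B) (hF : 0 ≤ F) (hR : 0 ≤ R)
    (hyi : IntervalIntegrable (fun σ => Real.sqrt (y σ)) volume 0 R)
    (hineq : ∀ r, 0 ≤ r → r ≤ R → y r ≤ B + 2 * F * ∫ σ in (0:ℝ)..r, Real.sqrt (y σ)) :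
    ∀ r, 0 ≤ r → r ≤ R → y r ≤ (Real.sqrt B + F * r) ^ 2 := by
  set Y : ℝ → ℝ := fun r => ∫ σ in (0:ℝ)..r, Real.sqrt (y σ) with hY
  set Z : ℝ → ℝ := fun r => B + 2 * F * Y r with hZ
  have hsub : ∀ r r', 0 ≤ r → r ≤ r' → r' ≤ R →
      IntervalIntegrable (fun σ => Real.sqrt (y σ)) volume r r' := by
    intro r r' hr hrr' hr'
    refine hyi.mono_set ?_
    rw [uIcc_of_le hR, uIcc_of_le hrr']
    exact Icc_subset_Icc hr hr'
  have hYdiff : ∀ r r', 0 ≤ r → r ≤ r' → r' ≤ R → Y r' - Y r = ∫ σ in r..r', Real.sqrt (y σ) := by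
    intro r r' hr hrr' hr'
    have := intervalIntegral.integral_add_adjacent_intervals (hsub 0 r le_rfl hr (hrr'.trans hr'))
      (hsub r r' hr hrr' hr')
    simp only [hY]
    linarith
  have hYmono : ∀ r r', 0 ≤ r → r ≤ r' → r' ≤ R → Y r ≤ Y r' := by
    intro r r' hr hrr' hr'
    have h1 := hYdiff r r' hr hrr' hr'
    have h0 : 0 ≤ ∫ σ in r..r', Real.sqrt (y σ) :=
      intervalIntegral.integral_nonneg hrr' fun σ _ => Real.sqrt_nonneg _
    linarith
  have hY0 : Y 0 = 0 := by simp [hY]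
  have hYnn : ∀ r, 0 ≤ r → r ≤ R → 0 ≤ Y r := fun r hr hrR => by
    have := hYmono 0 r le_rfl hr hrR
    rwa [hY0] at this
  have hZB : ∀ r, 0 ≤ r → r ≤ R → B ≤ Z r := fun r hr hrR => by
    have := hYnn r hr hrR
    simp only [hZ]
    nlinarith
  have hZpos : ∀ r, 0 ≤ r → r ≤ R → 0 < Z r := fun r hr hrR => hB.trans_le (hZB r hr hrR)
  have hyZ : ∀ σ, 0 ≤ σ → σ ≤ R → Real.sqrt (y σ) ≤ Real.sqrt (Z σ) := fun σ h1 h2 =>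
    Real.sqrt_le_sqrt (hineq σ h1 h2)
  have hZmono : ∀ r r', 0 ≤ r → r ≤ r' → r' ≤ R → Z r ≤ Z r' := fun r r' hr hrr' hr' => by
    have := hYmono r r' hr hrr' hr'
    simp only [hZ]
    nlinarith
  -- increment bound: `Z r' - Z r ≤ 2F (r' - r) √(Z r')`
  have hincr : ∀ r r', 0 ≤ r → r ≤ r' → r' ≤ R →
      Z r' - Z r ≤ 2 * F * ((r' - r) * Real.sqrt (Z r')) := by
    intro r r' hr hrr' hr'
    have h1 : ∫ σ in r..r', Real.sqrt (y σ) ≤ ∫ _σ in r..r', Real.sqrt (Z r') := by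
      refine intervalIntegral.integral_mono_on hrr' (hsub r r' hr hrr' hr') intervalIntegrable_const ?_
      intro σ hσ
      exact (hyZ σ (hr.trans hσ.1) (hσ.2.trans hr')).trans
        (Real.sqrt_le_sqrt (hZmono σ r' (hr.trans hσ.1) hσ.2 hr'))
    rw [intervalIntegral.integral_const, smul_eq_mul] at h1
    have h2 : Z r' - Z r = 2 * F * (Y r' - Y r) := by
      simp only [hZ]
      ring
    rw [h2, hYdiff r r' hr hrr' hr']
    exact mul_le_mul_of_nonneg_left h1 (by positivity)
  -- the function `r ↦ √(Z r) - F r` has increments `≤ C (r' - r)²`, `C = 2F²/√B`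
  have hsB : 0 < Real.sqrt B := Real.sqrt_pos.2 hB
  set C : ℝ := 2 * F ^ 2 / Real.sqrt B with hC
  have hC0 : 0 ≤ C := by positivity
  have hh : ∀ r r', 0 ≤ r → r ≤ r' → r' ≤ R →
      (Real.sqrt (Z r') - F * r') - (Real.sqrt (Z r) - F * r) ≤ C * (r' - r) ^ 2 := by
    intro r r' hr hrr' hr'
    have hP0 := hincr r r' hr hrr' hr'
    set a := Real.sqrt (Z r) with ha
    set b := Real.sqrt (Z r') with hb
    set d := r' - r with hd
    have hd0 : 0 ≤ d := by
      rw [hd]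
      linarith
    have haB : Real.sqrt B ≤ a := Real.sqrt_le_sqrt (hZB r hr (hrr'.trans hr'))
    have ha0 : 0 < a := hsB.trans_le haB
    have hab : a ≤ b := Real.sqrt_le_sqrt (hZmono r r' hr hrr' hr')
    have ha2 : a ^ 2 = Z r := Real.sq_sqrt (hZpos r hr (hrr'.trans hr')).le
    have hb2 : b ^ 2 = Z r' := Real.sq_sqrt (hZpos r' (hr.trans hrr') hr').le
    have hP : b ^ 2 - a ^ 2 ≤ 2 * F * (d * b) := by
      rw [ha2, hb2]
      exact hP0
    have hFd : 0 ≤ F * d := mul_nonneg hF hd0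
    have hgoal : b - a - F * d ≤ C * d ^ 2 := by
      by_cases hneg : b - a - F * d ≤ 0
      · exact hneg.trans (by positivity)
      · push Not at hneg
        have hab0 : 0 < a + b := by linarith
        have e1 : (b - a) * (a + b) = b ^ 2 - a ^ 2 := by ring
        have E1 : (b - a) * (a + b) ≤ 2 * F * (d * b) := by
          rw [e1]
          exact hP
        have e2 : (b - a - F * d) * (a + b) = (b - a) * (a + b) - F * d * a - F * d * b := by ring
        have e3 : F * d * (b - a) = F * d * b - F * d * a := by ring
        have E2 : (b - a - F * d) * (a + b) ≤ F * d * (b - a) := by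
          rw [e2, e3]
          nlinarith [E1]
        have E3 : F * d * (b - a) * (a + b) ≤ 2 * F ^ 2 * d ^ 2 * b := by
          calc F * d * (b - a) * (a + b) = F * d * ((b - a) * (a + b)) := by ring
            _ ≤ F * d * (2 * F * (d * b)) := mul_le_mul_of_nonneg_left E1 hFd
            _ = 2 * F ^ 2 * d ^ 2 * b := by ring
        have E4a : (b - a - F * d) * (a + b) * (a + b) ≤ F * d * (b - a) * (a + b) :=
          mul_le_mul_of_nonneg_right E2 hab0.le
        have E4b : 0 ≤ F ^ 2 * d ^ 2 * a := by positivity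
        have E4 : (b - a - F * d) * (a + b) * (a + b) ≤ 2 * F ^ 2 * d ^ 2 * (a + b) := by
          nlinarith [E4a, E3, E4b]
        have E5 : (b - a - F * d) * (a + b) ≤ 2 * F ^ 2 * d ^ 2 := le_of_mul_le_mul_right E4 hab0
        have E6a : (b - a - F * d) * Real.sqrt B ≤ (b - a - F * d) * (a + b) :=
          mul_le_mul_of_nonneg_left (by linarith) hneg.le
        have E6 : (b - a - F * d) * Real.sqrt B ≤ 2 * F ^ 2 * d ^ 2 := E6a.trans E5
        rw [hC, div_mul_eq_mul_div, le_div_iff₀ hsB]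
        linarith
    have e0 : b - F * r' - (a - F * r) = b - a - F * d := by
      rw [hd]
      ring
    linarith [hgoal, e0]
  -- telescoping: `√(Z r) - F r ≤ √(Z 0) = √B`
  intro r hr hrR
  have htel := le_of_increments_le_sq (h := fun ρ => Real.sqrt (Z ρ) - F * ρ) hC0 hr
    (fun ρ ρ' h1 h2 h3 => hh ρ ρ' h1 h2 (h3.trans hrR))
  have hZ0 : Z 0 = B := by simp [hZ, hY0]
  simp only [hZ0, mul_zero, sub_zero] at htel
  have h1 : Real.sqrt (Z r) ≤ Real.sqrt B + F * r := by linarith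
  have h2 : Z r ≤ (Real.sqrt B + F * r) ^ 2 := by
    have h0 : 0 ≤ Real.sqrt (Z r) := Real.sqrt_nonneg _
    have := pow_le_pow_left₀ h0 h1 2
    rwa [Real.sq_sqrt (hZpos r hr hrR).le] at this
  exact (hineq r hr hrR).trans h2

/-! ### §2 Energy after a slim restart: `‖w(r)‖₂ ≤ √B + ‖f‖₂ r` -/

/-- Cauchy–Schwarz for pairings of `L²` fields on `𝕋³` (local copy of the tree's folklore lemma
`Literature.Analysis.FluidPDE.abs_integral_inner_le_sqrt_mul_sqrt`, upper bound only). -/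
theorem integral_inner_le_sqrt_mul_sqrt {a w : UnitAddTorus (Fin 3) → EuclideanSpace ℝ (Fin 3)}
    (ha : MemLp a 2 volume) (hw : MemLp w 2 volume) :
    ∫ x, ⟪a x, w x⟫ ≤ Real.sqrt (∫ x, ‖a x‖ ^ 2) * Real.sqrt (∫ x, ‖w x‖ ^ 2) := by
  have h1 : |∫ x, ⟪a x, w x⟫| ≤ ∫ x, ‖a x‖ * ‖w x‖ := by
    rw [← Real.norm_eq_abs]
    refine (norm_integral_le_integral_norm _).trans (integral_mono_of_nonneg
      (ae_of_all _ fun x => norm_nonneg _) (ha.norm.integrable_mul hw.norm)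
      (ae_of_all _ fun x => norm_inner_le_norm _ _))
  have h2 := integral_mul_le_Lp_mul_Lq_of_nonneg Real.HolderConjugate.two_two
    (ae_of_all _ fun x => norm_nonneg (a x)) (ae_of_all _ fun x => norm_nonneg (w x))
    (by simpa using ha.norm) (by simpa using hw.norm)
  refine (le_abs_self _).trans (h1.trans (h2.trans_eq ?_))
  simp only [Real.rpow_two, one_div, Real.sqrt_eq_rpow]

/-- Along a global Leray–Hopf solution `t ↦ ‖w(t)‖₂ = √(∫‖w(t)‖²)` is interval integrable on `[0, R]`
(`√y ≤ 1 + y` and `y ∈ L¹(0, R]`). -/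
theorem intervalIntegrable_sqrt_energy {ν : ℝ} {F : ℝ → UnitAddTorus (Fin 3) → EuclideanSpace ℝ (Fin 3)}
    {a : UnitAddTorus (Fin 3) → EuclideanSpace ℝ (Fin 3)} {w : ℝ → UnitAddTorus (Fin 3) → EuclideanSpace ℝ (Fin 3)}
    (hw : IsGlobalLerayHopf ν F a w) {R : ℝ} (hR : 0 ≤ R) :
    IntervalIntegrable (fun σ => Real.sqrt (∫ x, ‖w σ x‖ ^ 2)) volume 0 R := by
  rcases hR.eq_or_lt with rfl | hRpos
  · exact IntervalIntegrable.refl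
  rw [intervalIntegrable_iff_integrableOn_Ioc_of_le hR]
  have hyi : IntegrableOn (fun σ => ∫ x, ‖w σ x‖ ^ 2) (Ioc 0 R) := hw.integrableOn_integral_norm_sq hRpos
  haveI : IsFiniteMeasure (volume.restrict (Ioc (0:ℝ) R)) :=
    ⟨by rw [Measure.restrict_apply_univ]; exact measure_Ioc_lt_top⟩
  have hmeas : AEStronglyMeasurable (fun σ => Real.sqrt (∫ x, ‖w σ x‖ ^ 2)) (volume.restrict (Ioc 0 R)) :=
    Real.continuous_sqrt.comp_aestronglyMeasurable hyi.aestronglyMeasurable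
  refine Integrable.mono' ((integrable_const (1:ℝ)).add hyi) hmeas (ae_of_all _ fun σ => ?_)
  simp only [Pi.add_apply, Real.norm_eq_abs, abs_of_nonneg (Real.sqrt_nonneg _)]
  have hy0 : 0 ≤ ∫ x, ‖w σ x‖ ^ 2 := integral_nonneg fun x => sq_nonneg _
  nlinarith [Real.sq_sqrt hy0, Real.sqrt_nonneg (∫ x, ‖w σ x‖ ^ 2),
    sq_nonneg (Real.sqrt (∫ x, ‖w σ x‖ ^ 2) - 1 / 2)]

/-- **Energy after a slim restart** (square-root Bihari, no Grönwall, uniform in `ν`): if `w` is a global Leray–Hopf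
solution with steady smooth force `f` from a datum `a` with `∫‖a‖² ≤ B`, then `∫‖w(r)‖² ≤ (√B + ‖f‖₂ r)²` for every
`r ≥ 0` (energy inequality from `0` + Cauchy–Schwarz give `y(r) ≤ B + 2‖f‖₂∫₀ʳ√y`). -/
theorem energy_le_sq_of_restart {f : UnitAddTorus (Fin 3) → EuclideanSpace ℝ (Fin 3)}
    (hf : FunctionSpaces.Torus.IsSmooth f) {ν : ℝ} (hν : 0 < ν)
    {a : UnitAddTorus (Fin 3) → EuclideanSpace ℝ (Fin 3)} {w : ℝ → UnitAddTorus (Fin 3) → EuclideanSpace ℝ (Fin 3)}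
    (hw : IsGlobalLerayHopf ν (fun _ => f) a w) {B : ℝ} (hB : ∫ x, ‖a x‖ ^ 2 ≤ B) {r : ℝ} (hr : 0 ≤ r) :
    ∫ x, ‖w r x‖ ^ 2 ≤ (Real.sqrt B + Real.sqrt (∫ x, ‖f x‖ ^ 2) * r) ^ 2 := by
  set Ef : ℝ := Real.sqrt (∫ x, ‖f x‖ ^ 2) with hEf
  have hEf0 : 0 ≤ Ef := Real.sqrt_nonneg _
  have hy0 : ∀ σ, 0 ≤ ∫ x, ‖w σ x‖ ^ 2 := fun σ => integral_nonneg fun x => sq_nonneg _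
  have hfL2 : MemLp f 2 volume := hf.memLp 2
  -- the integral inequality `y ρ ≤ B + 2‖f‖₂ ∫₀^ρ √y`
  have hineq : ∀ ρ, 0 ≤ ρ →
      ∫ x, ‖w ρ x‖ ^ 2 ≤ B + 2 * Ef * ∫ σ in (0:ℝ)..ρ, Real.sqrt (∫ x, ‖w σ x‖ ^ 2) := by
    intro ρ hρ
    have hE := (hw (ρ + 1) (by linarith)).energy_ineq_zero ρ ⟨hρ, by linarith⟩
    have hdiss : 0 ≤ ν * (∫⁻ σ in Ioo 0 ρ, FunctionSpaces.Torus.eGradNormSq (w σ)).toReal :=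
      mul_nonneg hν.le ENNReal.toReal_nonneg
    have hka : FunctionSpaces.Torus.kineticEnergy a = 2⁻¹ * ∫ x, ‖a x‖ ^ 2 := rfl
    have hkw : FunctionSpaces.Torus.kineticEnergy (w ρ) = 2⁻¹ * ∫ x, ‖w ρ x‖ ^ 2 := rfl
    rw [hkw, hka] at hE
    have hI0 : 0 ≤ ∫ σ in (0:ℝ)..ρ, Real.sqrt (∫ x, ‖w σ x‖ ^ 2) :=
      intervalIntegral.integral_nonneg hρ fun σ _ => Real.sqrt_nonneg _
    have hforce : ∫ σ in (0:ℝ)..ρ, ∫ x, ⟪f x, w σ x⟫ ≤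
        Ef * ∫ σ in (0:ℝ)..ρ, Real.sqrt (∫ x, ‖w σ x‖ ^ 2) := by
      by_cases hint : IntervalIntegrable (fun σ => ∫ x, ⟪f x, w σ x⟫) volume 0 ρ
      · rw [← intervalIntegral.integral_const_mul]
        refine intervalIntegral.integral_mono_on hρ hint
          ((intervalIntegrable_sqrt_energy hw hρ).const_mul Ef) fun σ hσ => ?_
        exact integral_inner_le_sqrt_mul_sqrt hfL2 (hw.memLp_two hσ.1)
      · rw [intervalIntegral.integral_undef hint]
        exact mul_nonneg hEf0 hI0
    linarith
  -- ε-regularised comparison (`B + ε > 0`), then `ε → 0⁺`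
  have hεb : ∀ ε : ℝ, 0 < ε → ∫ x, ‖w r x‖ ^ 2 ≤ (Real.sqrt (B + ε) + Ef * r) ^ 2 := by
    intro ε hε
    have hBε : 0 < B + ε := by
      have : 0 ≤ B := (hy0 0).trans ((hineq 0 le_rfl).trans_eq (by simp))
      linarith
    exact sq_bound_of_sqrt_integral_ineq (y := fun σ => ∫ x, ‖w σ x‖ ^ 2) hBε hEf0 hr
      (intervalIntegrable_sqrt_energy hw hr) (fun ρ hρ _ => (hineq ρ hρ).trans (by linarith)) r hr le_rfl
  have hc : Continuous (fun ε : ℝ => (Real.sqrt (B + ε) + Ef * r) ^ 2) := by fun_prop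
  have hlim : Tendsto (fun ε : ℝ => (Real.sqrt (B + ε) + Ef * r) ^ 2) (𝓝[>] 0)
      (𝓝 ((Real.sqrt B + Ef * r) ^ 2)) := by
    have := hc.tendsto 0
    simp only [add_zero] at this
    exact this.mono_left nhdsWithin_le_nhds
  exact ge_of_tendsto hlim (eventually_nhdsWithin_of_forall fun ε hε => hεb ε hε)

/-! ### §3 The registered stub `stub_slimGapEnergy` and the rung -/

/-- **Slim-gap energy bound** — verbatim `stub_slimGapEnergy` of the registered BC3 skeleton of item 27341
(`DenseReturnsLandSlim_birth(_paste).lean`): SLIM restart-good instants of ν-free bounded gap `G` along a global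
Leray–Hopf trajectory bound its MEAN ENERGY by `(√B + ‖f‖₂ G)²` (every instant `s ≥ G` lies within `G` after a slim
restart-good instant, so `‖u(s)‖₂ ≤ √B + ‖f‖₂ G` by `energy_le_sq_of_restart`; the prefix `[0, G]` is invisible to the
long-time mean by `IsGlobalLerayHopf.meanEnergy_translate`). -/
theorem slimGapEnergy : ∀ f : UnitAddTorus (Fin 3) → EuclideanSpace ℝ (Fin 3), Literature.Analysis.FunctionSpaces.Torus.IsSmooth f → Literature.Analysis.FunctionSpaces.Torus.IsDivFree f → Literature.Analysis.FunctionSpaces.Torus.HasZeroMean f → ∀ ν : ℝ, 0 < ν → ∀ (u₀ : UnitAddTorus (Fin 3) → EuclideanSpace ℝ (Fin 3)) (u : ℝ → UnitAddTorus (Fin 3) → EuclideanSpace ℝ (Fin 3)), Literature.Analysis.FluidPDE.Torus.IsGlobalLerayHopf ν (fun _ => f) u₀ u → ∀ B G : ℝ, 0 < G → (∀ t₀ : ℝ, 0 ≤ t₀ → ∃ t : ℝ, t₀ ≤ t ∧ t ≤ t₀ + G ∧ Literature.Analysis.FluidPDE.Torus.IsGlobalLerayHopf ν (fun _ => f) (u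 t) (fun τ => u (τ + t)) ∧ (∫ x, ‖u t x‖ ^ 2) ≤ B) → Literature.Analysis.FluidPDE.meanEnergy u ≤ (Real.sqrt B + Real.sqrt (∫ x, ‖f x‖ ^ 2) * G) ^ 2 := by
  intro f hfs _hfd _hfm ν hν u₀ u hu B G hG hsyn
  have hEf0 : 0 ≤ Real.sqrt (∫ x, ‖f x‖ ^ 2) := Real.sqrt_nonneg _
  have hsB0 : 0 ≤ Real.sqrt B := Real.sqrt_nonneg _
  -- pointwise bound past time `G`
  have hpt : ∀ s : ℝ, G ≤ s → ∫ x, ‖u s x‖ ^ 2 ≤ (Real.sqrt B + Real.sqrt (∫ x, ‖f x‖ ^ 2) * G) ^ 2 := by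
    intro s hs
    obtain ⟨t, ht1, ht2, hgood, hslim⟩ := hsyn (s - G) (by linarith)
    have hr : 0 ≤ s - t := by linarith
    have hrG : s - t ≤ G := by linarith
    have h1 := energy_le_sq_of_restart hfs hν hgood hslim hr
    simp only [sub_add_cancel] at h1
    refine h1.trans (pow_le_pow_left₀ (add_nonneg hsB0 (mul_nonneg hEf0 hr)) ?_ 2)
    nlinarith
  -- the long-time mean does not see the prefix `[0, G]`
  rw [← hu.meanEnergy_translate hG.le, meanEnergy_eq_longTimeAvgSup]
  exact longTimeAvgSup_le_const (fun t => integral_nonneg fun x => sq_nonneg _)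
    fun t ht => hpt (t + G) (by linarith)

/-- registered stub `stub_slimGapEnergy` of crux `DutyCycle.DenseReturnsLandSlim` (item 27341) — PROVED
(by name + signature, for the skeleton's `DenseReturnsLandSlim_of`). -/
theorem stub_slimGapEnergy : ∀ f : UnitAddTorus (Fin 3) → EuclideanSpace ℝ (Fin 3), Literature.Analysis.FunctionSpaces.Torus.IsSmooth f → Literature.Analysis.FunctionSpaces.Torus.IsDivFree f → Literature.Analysis.FunctionSpaces.Torus.HasZeroMean f → ∀ ν : ℝ, 0 < ν → ∀ (u₀ : UnitAddTorus (Fin 3) → EuclideanSpace ℝ (Fin 3)) (u : ℝ → UnitAddTorus (Fin 3) → EuclideanSpace ℝ (Fin 3)), Literature.Analysis.FluidPDE.Torus.IsGlobalLerayHopf ν (fun _ => f) u₀ u → ∀ B G : ℝ, 0 < G → (∀ t₀ : ℝ, 0 ≤ t₀ → ∃ t : ℝ, t₀ ≤ t ∧ t ≤ t₀ + G ∧ Literature.Analysis.FluidPDE.Torus.IsGlobalLerayHopf ν (fun _ => f) (u t) (fun τ => u (τ + t)) ∧ (∫ x, ‖u t x‖ ^ 2) ≤ B) → Literature.Analysis.FluidPDE.meanEnergy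 u ≤ (Real.sqrt B + Real.sqrt (∫ x, ‖f x‖ ^ 2) * G) ^ 2 :=
  slimGapEnergy

/-- **BC5 RUNG (theorem): Rβf restricted to syndetic-slim families.** A dense slim-loud family (hinge D) whose
trajectories also carry SLIM restart-good instants of ν-free bounded gap `G` has ν-free bounded MEAN energy
`(√B + ‖f‖₂ G)²` on the same trajectories — i.e. the currency hinge `DutyCycle.SlimMeanDenseReturns` (tree decl of item
27343) holds for that family. The antecedent is the ∃-statement `DenseSyndeticSlimReturns` of the registered BC3
skeleton of item 27341, INLINED verbatim (so that `denseReturnsLandSlim_rung ∘ stub_denseToSyndeticSlim` is the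
skeleton's `DenseReturnsLandSlim_proof` by `Iff.rfl`). -/
theorem denseReturnsLandSlim_rung
    (hDS : ∃ f : UnitAddTorus (Fin 3) → EuclideanSpace ℝ (Fin 3), Literature.Analysis.FunctionSpaces.Torus.IsSmooth f ∧ Literature.Analysis.FunctionSpaces.Torus.IsDivFree f ∧ Literature.Analysis.FunctionSpaces.Torus.HasZeroMean f ∧ ∃ ν : ℕ → ℝ, (∀ j, 0 < ν j) ∧ Filter.Tendsto ν Filter.atTop (nhds 0) ∧ ∃ B β δ G : ℝ, 0 < β ∧ 0 < δ ∧ 0 < G ∧ ∀ j : ℕ, ∃ (u₀ : UnitAddTorus (Fin 3) → EuclideanSpace ℝ (Fin 3)) (u : ℝ → UnitAddTorus (Fin 3) → EuclideanSpace ℝ (Fin 3)), Literature.Analysis.FluidPDE.Torus.IsGlobalLerayHopf (ν j) (fun _ => f) u₀ u ∧ (∀ t₀ : ℝ, 0 ≤ t₀ → ∃ t : ℝ, t₀ ≤ t ∧ t ≤ t₀ + G ∧ Literature.Analysis.FluidPDE.Torus.IsGlobalLerayHopf (ν j) (fun _ => f) (u t) (fun τ => u (τ + t)) ∧ (∫ x,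 ‖u t x‖ ^ 2) ≤ B) ∧ ∀ T₀ : ℝ, ∃ T : ℝ, T₀ ≤ T ∧ δ * T ≤ (MeasureTheory.volume {t : ℝ | t ∈ Set.Icc 0 T ∧ Literature.Analysis.FluidPDE.Torus.IsGlobalLerayHopf (ν j) (fun _ => f) (u t) (fun τ => u (τ + t)) ∧ (∫ x, ‖u t x‖ ^ 2) ≤ B ∧ β ≤ ∫ x, inner ℝ (f x) (u t x)}).toReal) :
    Summit.AnomalousDissipation.AnomalousDissipation.Theses.DutyCycle.SlimMeanDenseReturns := by
  obtain ⟨f, hfs, hfd, hfm, ν, hν, hν0, B, β, δ, G, hβ, hδ, hG, hj⟩ := hDS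
  refine ⟨f, hfs, hfd, hfm, ν, hν, hν0, B, β, δ, (Real.sqrt B + Real.sqrt (∫ x, ‖f x‖ ^ 2) * G) ^ 2, hβ, hδ,
    fun j => ?_⟩
  obtain ⟨u₀, u, hLH, hsyn, hdense⟩ := hj j
  exact ⟨u₀, u, hLH, slimGapEnergy f hfs hfd hfm (ν j) (hν j) u₀ u hLH B G hG hsyn, hdense⟩

end Summit.AnomalousDissipation.AnomalousDissipation.Theorems.DutyCycle

end
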